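import Summits.ResolutionOfSingularities.ResolutionOfSingularities.Theorems.PurelyInseparableDim4ChartAtlasSNCFarResonance
import HarnessLib

/-!
# Purely inseparable four-folds `z^p + F(x₁, …, x₄)`: far resonance, TWIN form — two far quadric members of equal height
# (cell `res-dim4-pi`, typ-2 g5)

[OURS · counted 0] (D-0157 DOOR 2; DR-157-C). Companion of p699206 (`…SNCFarResonance`, pair type `{x_j = -c'}` & quadric): here BOTH
far members are of quadric type — old `{xᵢ = -cᵢ}`, `{x_k = -c_k}` with `i ≠ k ∈ S ∩ S'`, `bᵢ, b_k ≠ 0`, `cᵢ ≠ 0` and EQUAL HEIGHTS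
`cᵢ/bᵢ = c_k/b_k` (resonance `b_k·cᵢ = bᵢ·c_k`). On the re-centred `x_j`-chart they read `((yᵢ + bᵢ) y_j + cᵢ)·𝒪`, `((y_k + b_k) y_j + c_k)·𝒪`
and meet the escaping global centre `Zc = V(y_0, y_{S'})` (`j ∉ S'`) at the common height `y_j = -cᵢ/bᵢ`, with parallel conormal classes
`bᵢ·dy_j ∥ b_k·dy_j`. PROVED here (no `sorry`, no new axiom): `not_hasSNCWith_of_two_quadrics` (model, translated frame),
`not_hasSNCWith_of_far_resonance_twin` (model, actual readings), `not_hasSNCWith_of_far_resonance_twin_chart_readings` (any `W`),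
**`not_hasSNCWith_globalCentre_of_far_resonance_twin`** (the blown-up `W`). With p699206 the far class is complete: two far members of
equal non-zero height, of either type, obstruct. Nothing here is a statement about resolution of singularities in dimension ≥ 4 /
characteristic `p` (NOT proved anywhere in this programme). bears_on: LADDER-RESOLUTION:D157-DOOR2 (res-dim4-pi). Supports
stmt-ResolutionOfSingularities-16155 (helper).
-/

-- every declaration of this summit lives under `Summit.ResolutionOfSingularities.ResolutionOfSingularities`
-- (summit = problem), which the duplicate-namespace linter flags; house convention (cf. the Target file).
set_option linter.dupNamespace false

noncomputable section

open MvPolynomial Finset CategoryTheory AlgebraicGeometry Opposite TopologicalSpace IsLocalRing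
open AlgebraicGeometry.Scheme.IdealSheafData (ofIdealTop vanishingIdeal)

namespace Summit.ResolutionOfSingularities.ResolutionOfSingularities.Theorems.PIDim4

open Literature.AlgebraicGeometry.Resolution
open Literature.AlgebraicGeometry.Resolution.AffinePointBlowup (P A γ coord Wtop ξ)
open Literature.AlgebraicGeometry.Hironaka2017.SpecOrders
open Literature.RingTheory.MvPolynomial (X_mem_span_X_image_iff)

namespace ChartDictionary

variable {K : Type} [Field K] {S S' T : Finset (Fin 4)} {i k j : Fin 4} {b b' lam : K} {W : Scheme.{0}} {π : W ⟶ P 4 K}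

/-! ## §1 Two quadrics `(yᵢ + b) y_j + λ yᵢ`, `(y_k + b') y_j + λ y_k` (translated frame) -/

/-- `(y_k + b')·y_j + λ·y_k ∉ (yᵢ, y_j)` for `k ∉ {i, j}`, `λ ≠ 0`. -/
theorem quadric_not_mem_span_X_pair (hki : k ≠ i) (hkj : k ≠ j) (b' : K) (hlam : lam ≠ 0) :
    ((X k.succ + C b') * X j.succ + C lam * X k.succ : A 4 K) ∉ Ideal.span (X '' ({i.succ, j.succ} : Set (Fin (4 + 1)))) := by
  classical
  intro hmem
  rw [mem_ideal_span_X_image] at hmem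
  have hsupp : Finsupp.single k.succ 1 ∈ ((X k.succ + C b') * X j.succ + C lam * X k.succ : A 4 K).support := by
    rw [MvPolynomial.mem_support_iff, coeff_add, coeff_C_mul, coeff_X, if_pos rfl, mul_one, mul_comm, coeff_X_mul',
      if_neg, zero_add]
    · exact hlam
    · rw [Finsupp.mem_support_iff, not_not]
      exact Finsupp.single_eq_of_ne (fun e => hkj (Fin.succ_inj.mp e).symm)
  obtain ⟨t, ht, hne⟩ := hmem _ hsupp
  rcases ht with rfl | ht
  · exact hne (Finsupp.single_eq_of_ne (fun e => hki (Fin.succ_inj.mp e).symm))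
  · rw [Set.mem_singleton_iff] at ht
    subst ht
    exact hne (Finsupp.single_eq_of_ne (fun e => hkj (Fin.succ_inj.mp e).symm))

/-- The two quadric sheaves are different (`i ≠ k`, `k ≠ j`, `λ ≠ 0`): the generic point of `V(yᵢ, y_j)` separates them. -/
theorem ofIdealTop_quadric_ne (hik : i ≠ k) (hkj : k ≠ j) (b b' : K) (hlam : lam ≠ 0) :
    ofIdealTop (Ideal.span {(γ 4 K).symm ((X i.succ + C b) * X j.succ + C lam * X i.succ)}) ≠
      ofIdealTop (Ideal.span {(γ 4 K).symm ((X k.succ + C b') * X j.succ + C lam * X k.succ)}) := by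
  intro e
  let Q : P 4 K := ⟨AffineCoordBlowup.IΛ 4 K ({i.succ, j.succ} : Set (Fin (4 + 1))), AffineCoordBlowup.isPrime_IΛ 4 K _⟩
  have h1 : Q ∈ (ofIdealTop (Ideal.span {(γ 4 K).symm ((X i.succ + C b) * X j.succ + C lam * X i.succ)})).support := by
    rw [ofIdealTop_span_γ_symm_eq_shf, mem_support_shf_iff, Ideal.span_singleton_le_iff_mem]
    have hXi : (X i.succ : A 4 K) ∈ Q.asIdeal := Ideal.subset_span ⟨i.succ, Set.mem_insert _ _, rfl⟩
    have hXj : (X j.succ : A 4 K) ∈ Q.asIdeal := Ideal.subset_span ⟨j.succ, Set.mem_insert_of_mem _ (Set.mem_singleton _), rfl⟩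
    exact Ideal.add_mem _ (Ideal.mul_mem_left _ _ hXj) (Ideal.mul_mem_left _ _ hXi)
  rw [e, ofIdealTop_span_γ_symm_eq_shf, mem_support_shf_iff, Ideal.span_singleton_le_iff_mem] at h1
  exact quadric_not_mem_span_X_pair hik.symm hkj b' hlam h1

/-- **TWIN FAR RESONANCE ON THE MODEL (translated frame).** `i ≠ k ∈ T`, `j ∉ T`, `b, b' ≠ 0`, `λ ≠ 0`; any list on `𝔸⁵` containing
the quadrics `((yᵢ + b) y_j + λ yᵢ)·𝒪` and `((y_k + b') y_j + λ y_k)·𝒪` does NOT have snc with `𝓘Λ_T`: at the generic point of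
`V(y_0, y_T, y_j)` the germ `y_j = (y_k + b')⁻¹ (q_k - λ y_k)` lies in `(u_c) + 𝓘Λ_T`, hence so does `qᵢ` — minimality. -/
theorem not_hasSNCWith_of_two_quadrics (hiT : i ∈ T) (hkT : k ∈ T) (hik : i ≠ k) (hjT : j ∉ T) (hb : b ≠ 0) (hb' : b' ≠ 0)
    (hlam : lam ≠ 0) {E : List (P 4 K).IdealSheafData}
    (hDi : ofIdealTop (Ideal.span {(γ 4 K).symm ((X i.succ + C b) * X j.succ + C lam * X i.succ)}) ∈ E)
    (hDk : ofIdealTop (Ideal.span {(γ 4 K).symm ((X k.succ + C b') * X j.succ + C lam * X k.succ)}) ∈ E) :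
    ¬ HasSNCWith E (AffineCoordBlowup.𝓘Λ 4 K (insert 0 (Fin.succ '' (T : Set (Fin 4))))) := by
  classical
  intro h
  have hij : i ≠ j := fun e => hjT (e ▸ hiT)
  have hkj : k ≠ j := fun e => hjT (e ▸ hkT)
  set Λ : Set (Fin (4 + 1)) := insert 0 (Fin.succ '' (T : Set (Fin 4))) with hΛ
  set qi : A 4 K := (X i.succ + C b) * X j.succ + C lam * X i.succ with hqi
  set qk : A 4 K := (X k.succ + C b') * X j.succ + C lam * X k.succ with hqk
  set Di := ofIdealTop (Ideal.span {(γ 4 K).symm qi}) with hDidef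
  set Dk := ofIdealTop (Ideal.span {(γ 4 K).symm qk}) with hDkdef
  have hDi' : Di = shf (A 4 K) (Ideal.span {qi}) := ofIdealTop_span_γ_symm_eq_shf _
  have hDk' : Dk = shf (A 4 K) (Ideal.span {qk}) := ofIdealTop_span_γ_symm_eq_shf _
  have hC' : AffineCoordBlowup.𝓘Λ 4 K Λ = shf (A 4 K) (AffineCoordBlowup.IΛ 4 K Λ) :=
    Cruxes.EquisingularLiftNat.Sections.ND.𝓘Λ_eq_idealSheafOf 4 K Λ
  let Pt : P 4 K := ⟨AffineCoordBlowup.IΛ 4 K (insert 0 (Fin.succ '' ((insert j T : Finset (Fin 4)) : Set (Fin 4)))),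
    AffineCoordBlowup.isPrime_IΛ 4 K _⟩
  have hle : AffineCoordBlowup.IΛ 4 K Λ ≤ Pt.asIdeal := by
    refine Ideal.span_mono (Set.image_mono (Set.insert_subset_insert (Set.image_mono ?_)))
    rw [Finset.coe_insert]
    exact Set.subset_insert _ _
  have hXj : (X j.succ : A 4 K) ∈ Pt.asIdeal :=
    Ideal.subset_span ⟨j.succ, Set.mem_insert_of_mem _ ⟨j, by rw [Finset.coe_insert]; exact Set.mem_insert _ _, rfl⟩, rfl⟩
  have hXi : (X i.succ : A 4 K) ∈ AffineCoordBlowup.IΛ 4 K Λ :=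
    Ideal.subset_span ⟨i.succ, Set.mem_insert_of_mem _ ⟨i, Finset.mem_coe.mpr hiT, rfl⟩, rfl⟩
  have hXk : (X k.succ : A 4 K) ∈ AffineCoordBlowup.IΛ 4 K Λ :=
    Ideal.subset_span ⟨k.succ, Set.mem_insert_of_mem _ ⟨k, Finset.mem_coe.mpr hkT, rfl⟩, rfl⟩
  have hPC : Pt ∈ (AffineCoordBlowup.𝓘Λ 4 K Λ).support := by
    rw [hC', mem_support_shf_iff]; exact hle
  have hPDi : Pt ∈ Di.support := by
    rw [hDi', mem_support_shf_iff, Ideal.span_singleton_le_iff_mem, hqi]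
    exact Ideal.add_mem _ (Ideal.mul_mem_left _ _ hXj) (Ideal.mul_mem_left _ _ (hle hXi))
  have hPDk : Pt ∈ Dk.support := by
    rw [hDk', mem_support_shf_iff, Ideal.span_singleton_le_iff_mem, hqk]
    exact Ideal.add_mem _ (Ideal.mul_mem_left _ _ hXj) (Ideal.mul_mem_left _ _ (hle hXk))
  -- the unit `y_k + b'` at that point
  haveI : Pt.asIdeal.IsPrime := Pt.2
  haveI : IsLocalization.AtPrime (St (A 4 K) Pt) Pt.asIdeal :=
    Literature.AlgebraicGeometry.Hironaka2017.SpecOrders.isLocSt (A 4 K) Pt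
  have hunit : IsUnit (algebraMap (A 4 K) (St (A 4 K) Pt) (X k.succ + C b')) := by
    refine IsLocalization.map_units (St (A 4 K) Pt) (⟨X k.succ + C b', ?_⟩ : Pt.asIdeal.primeCompl)
    intro hmem
    have hCb : (C b' : A 4 K) ∈ Pt.asIdeal := by
      have h2 := Pt.asIdeal.sub_mem hmem (hle hXk)
      rwa [add_sub_cancel_left] at h2
    exact Pt.2.ne_top ((Ideal.eq_top_iff_one _).mpr (by
      have h3 := Pt.asIdeal.mul_mem_left (C b'⁻¹) hCb
      rwa [← C_mul, inv_mul_cancel₀ hb', C_1] at h3))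
  -- the snc data at that point
  obtain ⟨hreg, u, hu, ⟨ι, hιinj, hι⟩, hC⟩ := h Pt
  haveI := hreg
  obtain ⟨Sset, hS⟩ := hC hPC
  set φ := algebraMap (A 4 K) (St (A 4 K) Pt) with hφ
  set a := ι ⟨Di, hDi, hPDi⟩ with ha
  set c := ι ⟨Dk, hDk, hPDk⟩ with hc
  have hac : a ≠ c := fun e => by
    have h1 := congrArg Subtype.val (hιinj e)
    exact ofIdealTop_quadric_ne (K := K) hik hkj b b' hlam h1
  have h1 : Ideal.span {φ qi} = Ideal.span {u a} := by
    rw [ha, ← hι ⟨Di, hDi, hPDi⟩]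
    change _ = stalkIdeal Di Pt
    rw [hDi', stalkIdeal_shf, Ideal.map_span, Set.image_singleton]
  have h2 : Ideal.span {φ qk} = Ideal.span {u c} := by
    rw [hc, ← hι ⟨Dk, hDk, hPDk⟩]
    change _ = stalkIdeal Dk Pt
    rw [hDk', stalkIdeal_shf, Ideal.map_span, Set.image_singleton]
  have h3 : (AffineCoordBlowup.IΛ 4 K Λ).map φ = Ideal.span (u '' Sset) := by
    rw [← hS, hC', stalkIdeal_shf]
  have hxi : φ (X i.succ) ∈ (AffineCoordBlowup.IΛ 4 K Λ).map φ := Ideal.mem_map_of_mem _ hXi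
  have hxk : φ (X k.succ) ∈ (AffineCoordBlowup.IΛ 4 K Λ).map φ := Ideal.mem_map_of_mem _ hXk
  -- `y_j ∈ (u_c) + (y_0, y_T)·𝒪_𝔭`: from `q_k = (y_k + b') y_j + λ y_k` and the unit `y_k + b'`
  have hyj : φ (X j.succ) ∈ Ideal.span {u c} ⊔ (AffineCoordBlowup.IΛ 4 K Λ).map φ := by
    have hqk' : φ qk ∈ Ideal.span {u c} := by rw [← h2]; exact Ideal.mem_span_singleton_self _
    have hprod : φ ((X k.succ + C b') * X j.succ) ∈ Ideal.span {u c} ⊔ (AffineCoordBlowup.IΛ 4 K Λ).map φ := by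
      have h4 := Ideal.sub_mem _ (Ideal.mem_sup_left hqk')
        (Ideal.mem_sup_right (Ideal.mul_mem_left _ (φ (C lam)) hxk) :
          _ ∈ Ideal.span {u c} ⊔ (AffineCoordBlowup.IΛ 4 K Λ).map φ)
      rwa [hqk, map_add, map_mul φ (C lam), add_sub_cancel_right] at h4
    obtain ⟨v, hv⟩ := hunit
    rw [map_mul, ← hv] at hprod
    have h5 := Ideal.mul_mem_left _ (↑v⁻¹ : St (A 4 K) Pt) hprod
    rwa [← mul_assoc, Units.inv_mul, one_mul] at h5
  -- Step 1: `a ∉ Sset` — otherwise `qᵢ ∈ (y_0, y_T)·𝒪_𝔭`, so `(yᵢ + b) y_j ∈ …`, so `y_j ∈ (y_0, y_T)`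
  have hunit_i : IsUnit (φ (X i.succ + C b)) := by
    refine IsLocalization.map_units (St (A 4 K) Pt) (⟨X i.succ + C b, ?_⟩ : Pt.asIdeal.primeCompl)
    intro hmem
    have hCb : (C b : A 4 K) ∈ Pt.asIdeal := by
      have h2 := Pt.asIdeal.sub_mem hmem (hle hXi)
      rwa [add_sub_cancel_left] at h2
    exact Pt.2.ne_top ((Ideal.eq_top_iff_one _).mpr (by
      have h3 := Pt.asIdeal.mul_mem_left (C b⁻¹) hCb
      rwa [← C_mul, inv_mul_cancel₀ hb, C_1] at h3))
  have haS : a ∉ Sset := by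
    intro haS
    have hua : u a ∈ (AffineCoordBlowup.IΛ 4 K Λ).map φ := by
      rw [h3]; exact Ideal.subset_span ⟨a, haS, rfl⟩
    have hgen : φ qi ∈ (AffineCoordBlowup.IΛ 4 K Λ).map φ := by
      have h4 : φ qi ∈ Ideal.span {u a} := by rw [← h1]; exact Ideal.mem_span_singleton_self _
      obtain ⟨w, hw⟩ := Ideal.mem_span_singleton'.mp h4
      rw [← hw]
      exact Ideal.mul_mem_left _ _ hua
    have hprod : φ ((X i.succ + C b) * X j.succ) ∈ (AffineCoordBlowup.IΛ 4 K Λ).map φ := by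
      have h4 := Ideal.sub_mem _ hgen (Ideal.mul_mem_left _ (φ (C lam)) hxi)
      rwa [hqi, map_add, map_mul φ (C lam), add_sub_cancel_right] at h4
    have hxj : φ (X j.succ) ∈ (AffineCoordBlowup.IΛ 4 K Λ).map φ := by
      obtain ⟨v, hv⟩ := hunit_i
      rw [map_mul, ← hv] at hprod
      have h5 := Ideal.mul_mem_left _ (↑v⁻¹ : St (A 4 K) Pt) hprod
      rwa [← mul_assoc, Units.inv_mul, one_mul] at h5
    exact X_succ_not_mem_IΛ hjT (mem_IΛ_of_algebraMap_mem_map Pt hle hxj)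
  -- Step 2: `u_a ∈ (u_t : t ∈ insert c Sset)` — minimality
  have hac' : a ∉ insert c Sset := by
    rintro (e | e)
    · exact hac e
    · exact haS e
  refine not_mem_span_image_of_not_mem rfl u hu hac' ?_
  have h4 : u a ∈ Ideal.span {φ qi} := by rw [h1]; exact Ideal.mem_span_singleton_self _
  obtain ⟨w, hw⟩ := Ideal.mem_span_singleton'.mp h4
  rw [← hw]
  refine Ideal.mul_mem_left _ _ ?_
  have hsub : Ideal.span {u c} ⊔ (AffineCoordBlowup.IΛ 4 K Λ).map φ ≤ Ideal.span (u '' insert c Sset) := by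
    refine sup_le ?_ ?_
    · exact Ideal.span_mono (Set.singleton_subset_iff.mpr (Set.mem_image_of_mem u (Set.mem_insert c Sset)))
    · rw [h3]; exact Ideal.span_mono (Set.image_mono (Set.subset_insert _ _))
  rw [hqi, map_add, map_mul, map_mul]
  exact Ideal.add_mem _ (Ideal.mul_mem_left _ _ (hsub hyj)) (Ideal.mul_mem_left _ _ (hsub (Ideal.mem_sup_right hxi)))

/-! ## §2 The actual readings and the obstruction on `W` -/

/-- **TWIN FAR RESONANCE ON THE MODEL.** `i ≠ k ∈ T`, `j ∉ T`, `bᵢ, b_k, cᵢ ≠ 0`, resonance `b_k·cᵢ = bᵢ·c_k`; any list containing the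
quadrics `((yᵢ + bᵢ) y_j + cᵢ)·𝒪` and `((y_k + b_k) y_j + c_k)·𝒪` does NOT have snc with `𝓘Λ_T`. -/
theorem not_hasSNCWith_of_far_resonance_twin {bi bk ci ck : K} (hiT : i ∈ T) (hkT : k ∈ T) (hik : i ≠ k) (hjT : j ∉ T)
    (hbi : bi ≠ 0) (hbk : bk ≠ 0) (hci : ci ≠ 0) (hres : bk * ci = bi * ck) {E : List (P 4 K).IdealSheafData}
    (hDi : ofIdealTop (Ideal.span {(γ 4 K).symm ((X i.succ + C bi) * X j.succ + C ci)}) ∈ E)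
    (hDk : ofIdealTop (Ideal.span {(γ 4 K).symm ((X k.succ + C bk) * X j.succ + C ck)}) ∈ E) :
    ¬ HasSNCWith E (AffineCoordBlowup.𝓘Λ 4 K (insert 0 (Fin.succ '' (T : Set (Fin 4))))) := by
  classical
  intro h
  have hij : i ≠ j := fun e => hjT (e ▸ hiT)
  have hkj : k ≠ j := fun e => hjT (e ▸ hkT)
  set lam : K := -(ci / bi) with hlamdef
  have hlam : lam ≠ 0 := by rw [hlamdef]; exact neg_ne_zero.mpr (div_ne_zero hci hbi)
  set cv : Fin (4 + 1) → K := Function.update 0 j.succ lam with hcv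
  have hcvΛ : ∀ t ∈ insert (0 : Fin (4 + 1)) (Fin.succ '' (T : Set (Fin 4))), cv t = 0 := by
    rintro t (rfl | ⟨s, hs, rfl⟩)
    · rw [hcv, Function.update_of_ne (Fin.succ_ne_zero j).symm]; rfl
    · rw [hcv, Function.update_of_ne (fun e => hjT (by rw [← Fin.succ_inj.mp e]; exact Finset.mem_coe.mp hs))]; rfl
  have hcvj : cv j.succ = lam := by rw [hcv, Function.update_self]
  have hcvi : cv i.succ = 0 := by rw [hcv, Function.update_of_ne (fun e => hij (Fin.succ_inj.mp e))]; rfl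
  have hcvk : cv k.succ = 0 := by rw [hcv, Function.update_of_ne (fun e => hkj (Fin.succ_inj.mp e))]; rfl
  let σ := AffinePointBlowup.translateEquiv (K := K) (n := 4) cv
  haveI : IsIso (CommRingCat.ofHom (σ : A 4 K →+* A 4 K)) := (inferInstance : IsIso σ.toRingEquiv.toCommRingCatIso.hom)
  have h' := h.comap_of_isOpenImmersion (Spec.map (CommRingCat.ofHom (σ : A 4 K →+* A 4 K)))
  rw [comap_translate_𝓘Λ cv _ hcvΛ] at h'
  have hσC : ∀ r : K, σ (C r) = C r := fun r => σ.commutes r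
  have hσX : ∀ t : Fin (4 + 1), σ (X t) = X t + C (cv t) := fun t => AffinePointBlowup.translateEquiv_X cv t
  refine not_hasSNCWith_of_two_quadrics hiT hkT hik hjT hbi hbk hlam ?_ ?_ h'
  · refine List.mem_map.mpr ⟨_, hDi, ?_⟩
    have hσ : σ ((X i.succ + C bi) * X j.succ + C ci) = (X i.succ + C bi) * X j.succ + C lam * X i.succ := by
      simp only [map_add, map_mul, hσX, hσC, hcvj, hcvi, C_0, add_zero]
      have hconst : (C bi * C lam + C ci : A 4 K) = 0 := by
        rw [← C_mul, ← C_add, hlamdef, mul_neg, mul_div_cancel₀ _ hbi, neg_add_cancel, C_0]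
      linear_combination hconst
    rw [comap_ofIdealTop_span_γ_symm, RingHom.coe_coe, hσ]
  · refine List.mem_map.mpr ⟨_, hDk, ?_⟩
    have hσ : σ ((X k.succ + C bk) * X j.succ + C ck) = (X k.succ + C bk) * X j.succ + C lam * X k.succ := by
      simp only [map_add, map_mul, hσX, hσC, hcvj, hcvk, C_0, add_zero]
      have hck : ck = bk * (ci / bi) := by field_simp; linear_combination -hres
      have hconst : (C bk * C lam + C ck : A 4 K) = 0 := by
        rw [← C_mul, ← C_add, hlamdef, hck, mul_neg, neg_add_cancel, C_0]
      linear_combination hconst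
    rw [comap_ofIdealTop_span_γ_symm, RingHom.coe_coe, hσ]

/-- **TWIN FAR RESONANCE, GLOBAL FORM** (any `W` with an open immersion `φ : 𝔸⁵ → W` carrying the readings). -/
theorem not_hasSNCWith_of_far_resonance_twin_chart_readings {W : Scheme.{0}} [IsLocallyNoetherian W] (φ : P 4 K ⟶ W)
    [IsOpenImmersion φ] {bi bk ci ck : K} (hiT : i ∈ T) (hkT : k ∈ T) (hik : i ≠ k) (hjT : j ∉ T) (hbi : bi ≠ 0) (hbk : bk ≠ 0)
    (hci : ci ≠ 0) (hres : bk * ci = bi * ck) {E : List W.IdealSheafData} {Zc Di Dk : W.IdealSheafData} (hDiE : Di ∈ E)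
    (hDkE : Dk ∈ E) (hZc : Zc.comap φ = AffineCoordBlowup.𝓘Λ 4 K (insert 0 (Fin.succ '' (T : Set (Fin 4)))))
    (hDi : Di.comap φ = ofIdealTop (Ideal.span {(γ 4 K).symm ((X i.succ + C bi) * X j.succ + C ci)}))
    (hDk : Dk.comap φ = ofIdealTop (Ideal.span {(γ 4 K).symm ((X k.succ + C bk) * X j.succ + C ck)})) :
    ¬ HasSNCWith E Zc := by
  intro h
  have h' := h.comap_of_isOpenImmersion φ
  rw [hZc] at h'
  refine not_hasSNCWith_of_far_resonance_twin hiT hkT hik hjT hbi hbk hci hres ?_ ?_ h'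
  · rw [← hDi]; exact List.mem_map_of_mem hDiE
  · rw [← hDk]; exact List.mem_map_of_mem hDkE

variable {Θⱼ : A 4 K ≃ₐ[K] A 4 K} {bv cvec : Fin 4 → K}

/-- **TWIN FAR RESONANCE ON THE BLOWN-UP SCHEME.** `π : W → 𝔸⁵` any blowing up along `V(z, x_S)`, `Θⱼ` a re-centring of the
`x_j`-chart at `b` (`b_j = 0`), `Zc` the escaping global centre (`j ∉ S'`), and two FAR old members `{xᵢ = -cᵢ}`, `{x_k = -c_k}` with
`i ≠ k ∈ S ∩ S'`, `bᵢ, b_k, cᵢ ≠ 0` and equal heights `b_k·cᵢ = bᵢ·c_k`: `¬ HasSNCWith E Zc` for every boundary `E` on `W` containing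
their strict transforms. -/
theorem not_hasSNCWith_globalCentre_of_far_resonance_twin (hj : j ∈ S) (hi : i ∈ S) (hk : k ∈ S) (hiS' : i ∈ S')
    (hkS' : k ∈ S') (hik : i ≠ k) (hjS' : j ∉ S') (hbj : bv j = 0) (hbi : bv i ≠ 0) (hbk : bv k ≠ 0) (hci : cvec i ≠ 0)
    (hres : bv k * cvec i = bv i * cvec k) (hs : ∀ t : Fin 4, Θⱼ (X t.succ) = X t.succ + C (bv t))
    (hπ : IsBlowup π (AffineCoordBlowup.𝓘Λ 4 K (insert 0 (Fin.succ '' (S : Set (Fin 4)))))) {E : List W.IdealSheafData}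
    (hDi : strictTransformIdeal π (AffineCoordBlowup.𝓘Λ 4 K (insert 0 (Fin.succ '' (S : Set (Fin 4)))))
      (ofIdealTop (Ideal.span {(γ 4 K).symm (X i.succ + C (cvec i))})) ∈ E)
    (hDk : strictTransformIdeal π (AffineCoordBlowup.𝓘Λ 4 K (insert 0 (Fin.succ '' (S : Set (Fin 4)))))
      (ofIdealTop (Ideal.span {(γ 4 K).symm (X k.succ + C (cvec k))})) ∈ E) :
    haveI : IsIso (CommRingCat.ofHom (Θⱼ : A 4 K →+* A 4 K)) := (inferInstance : IsIso Θⱼ.toRingEquiv.toCommRingCatIso.hom)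
    ¬ HasSNCWith E (vanishingIdeal (closureImage
        (Spec.map (CommRingCat.ofHom (Θⱼ : A 4 K →+* A 4 K)) ≫ AffineCoordBlowup.chartImm hπ (succ_mem_centreVars hj))
        ((AffineCoordBlowup.𝓘Λ 4 K (insert 0 (Fin.succ '' (S' : Set (Fin 4))))).support : Set (P 4 K)))) := by
  haveI hiso : IsIso (CommRingCat.ofHom (Θⱼ : A 4 K →+* A 4 K)) :=
    (inferInstance : IsIso Θⱼ.toRingEquiv.toCommRingCatIso.hom)
  haveI : IsProper π := hπ.isProper
  haveI : IsLocallyNoetherian W := LocallyOfFiniteType.isLocallyNoetherian π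
  have hij : i ≠ j := fun e => hjS' (e ▸ hiS')
  have hkj : k ≠ j := fun e => hjS' (e ▸ hkS')
  have hck : cvec k ≠ 0 := by
    intro h0
    rw [h0, mul_zero] at hres
    exact (mul_ne_zero hbk hci) hres
  refine not_hasSNCWith_of_far_resonance_twin_chart_readings
    (Spec.map (CommRingCat.ofHom (Θⱼ : A 4 K →+* A 4 K)) ≫ AffineCoordBlowup.chartImm hπ (succ_mem_centreVars hj))
    hiS' hkS' hik hjS' hbi hbk hci hres hDi hDk (comap_globalCentre _ _) ?_ ?_
  · rw [comap_recenter_chart_strictTransform_far hj hi hij hci hs hπ, hbj, C_0, add_zero]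
  · rw [comap_recenter_chart_strictTransform_far hj hk hkj hck hs hπ, hbj, C_0, add_zero]

end ChartDictionary

end Summit.ResolutionOfSingularities.ResolutionOfSingularities.Theorems.PIDim4

end
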